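import Literature.Computability.FineGrained.DTWTraversalBounds
import HarnessLib

/-!
# The coordinate / vector gadget for one-dimensional DTW: rigid alignment by heights

The first level of the reduction from Orthogonal Vectors to dynamic time warping on
one-dimensional curves (K. Bringmann, M. Künnemann, *Quadratic conditional lower bounds for
string problems and dynamic time warping*, FOCS 2015, §3.1 "coordinate gadgets" / "vector
gadgets", cf. Lemma 6.1 for their coordinate values). We use a variant that exploits the
real line instead of BK15's alignment gadget at this level: the `ℓ`-th point of a vector gadget
is placed at *height* `6 ℓ` plus a *low part* in `{0, 1, 2, 3}`,

* `lift h [v₀, v₁, …] = [6h + v₀, 6(h+1) + v₁, …]` (`DTWRed.lift`);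
* low parts of the `x`-side vector gadget of `a ∈ {0,1}^d`: `[xval a₀, xval ¬a₀, xval a₁, …]`
  with `xval 1 = 3`, `xval 0 = 1` (`lowsX`), and of the `y`-side gadget of `b`:
  `[yval b₀, 2, yval b₁, 2, …]` with `yval 1 = 0`, `yval 0 = 2` (`lowsY`), so that
  `|xval α - yval β| = 3` if `α = β = 1` and `= 1` otherwise, and `|xval ¬α - 2| = 1`; the second
  ("complement") point makes the *sum* of a gadget independent of `a` — the "type" condition
  needed one level up (`sum_lowsX`).

Points at different heights are at distance `≥ 3 ≥` every same-height cost, so the diagonal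
traversal is optimal (**`dtwDist_lift_lift`**: `dtwDist (lift h xs) (lift h ys) = Σ_ℓ |xs_ℓ - ys_ℓ|`
for low parts in `[0, 3]`, proved by the potential principle of `DTWTraversalBounds` with the
potential `D (max p q)`, `D p = Σ_{ℓ ≥ p} |xs_ℓ - ys_ℓ|`), whence the exact value
**`dtwDist_vgX_vgY`**: `dtwDist (vgX h a) (vgY h b) = 2 |a| + 2 ⟨a, b⟩`.

## References

* K. Bringmann, M. Künnemann, FOCS 2015 (arXiv:1502.01063), §3.1 (coordinate and vector
  gadgets, Claim 3.4), §6 Lemma 6.1 (coordinate values for DTW).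
-/

namespace Literature.Computability.FineGrained

open Cryptography

namespace DTWRed

/-! ### Height-separated sequences -/

/-- Place the points `v₀, v₁, …` at heights `6h, 6(h+1), …`: `lift h vs = [6h + v₀, 6(h+1) + v₁, …]`.
[folklore] -/
def lift : ℕ → List ℤ → List ℤ
  | _, [] => []
  | h, v :: vs => (6 * (h : ℤ) + v) :: lift (h + 1) vs

/-- `lift` preserves lengths. [folklore] -/
@[simp] theorem length_lift : ∀ (h : ℕ) (vs : List ℤ), (lift h vs).length = vs.length
  | _, [] => rfl
  | h, _ :: vs => by simp [lift, length_lift (h + 1) vs]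

/-- Suffixes of a lifted sequence are lifted suffixes. [folklore] -/
theorem drop_lift : ∀ (p h : ℕ) (vs : List ℤ), (lift h vs).drop p = lift (h + p) (vs.drop p)
  | 0, _, vs => by cases vs <;> simp [lift]
  | p + 1, h, [] => by simp [lift]
  | p + 1, h, v :: vs => by
    rw [lift, List.drop_succ_cons, List.drop_succ_cons, drop_lift p (h + 1) vs, Nat.add_right_comm,
      Nat.add_assoc]

/-- The points of a lifted sequence. [folklore] -/
theorem getElem_lift {h : ℕ} {vs : List ℤ} {p : ℕ} (hp : p < (lift h vs).length) :
    (lift h vs)[p] = 6 * ((h : ℤ) + p) + vs[p]'(by simpa using hp) := by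
  have hp' : p < vs.length := by simpa using hp
  have h1 : (lift h vs).drop p = (lift h vs)[p] :: (lift h vs).drop (p + 1) := List.drop_eq_getElem_cons hp
  rw [drop_lift, List.drop_eq_getElem_cons hp', lift] at h1
  have := List.head_eq_of_cons_eq h1
  push_cast at this; linarith

/-- The sum of a lifted sequence: `Σ lift h vs = Σ vs + 6 Σ_{ℓ < |vs|} (h + ℓ)`; we only record the
form "the sum depends on `vs` only through `Σ vs` and `|vs|`". [folklore] -/
theorem sum_lift : ∀ (h : ℕ) (vs : List ℤ),
    (lift h vs).sum = vs.sum + 6 * (∑ ℓ ∈ Finset.range vs.length, ((h : ℤ) + ℓ))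
  | _, [] => by simp [lift]
  | h, v :: vs => by
    rw [lift, List.sum_cons, sum_lift (h + 1) vs, List.sum_cons, List.length_cons,
      Finset.sum_range_succ']
    push_cast; ring

/-- Membership in a lifted sequence. [folklore] -/
theorem mem_lift_iff : ∀ (h : ℕ) (vs : List ℤ) (w : ℤ),
    w ∈ lift h vs ↔ ∃ p : ℕ, ∃ hp : p < vs.length, w = 6 * ((h : ℤ) + p) + vs[p]
  | _, [], w => by simp [lift]
  | h, v :: vs, w => by
    rw [lift, List.mem_cons, mem_lift_iff (h + 1) vs w]
    constructor
    · rintro (rfl | ⟨p, hp, rfl⟩)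
      · exact ⟨0, by simp, by simp⟩
      · exact ⟨p + 1, by simpa using hp, by push_cast; simp; ring⟩
    · rintro ⟨p, hp, rfl⟩
      cases p with
      | zero => left; simp
      | succ p => right; exact ⟨p, by simpa using hp, by push_cast; simp; ring⟩

/-- Bounds of the points of a lifted sequence with low parts in `[0, 3]`:
`0 ≤ w ≤ 6 (h + |vs|) - 3`. [folklore] -/
theorem bounds_of_mem_lift {h : ℕ} {vs : List ℤ} (hv : ∀ v ∈ vs, 0 ≤ v ∧ v ≤ 3) {w : ℤ}
    (hw : w ∈ lift h vs) : 0 ≤ w ∧ w ≤ 6 * ((h : ℤ) + vs.length) - 3 := by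
  obtain ⟨p, hp, rfl⟩ := (mem_lift_iff h vs w).1 hw
  have := hv _ (List.getElem_mem hp)
  have hp' : (p : ℤ) + 1 ≤ vs.length := by exact_mod_cast hp
  constructor <;> nlinarith

/-! ### The rigid alignment theorem -/

section rigid

variable (xs ys : List ℤ)

/-- The cost of the diagonal from position `p` on: `D p = Σ_{ℓ ≥ p} |xs_ℓ - ys_ℓ|`. [folklore] -/
def diagCost (p : ℕ) : ℕ :=
  (List.zipWith (fun a c => (a - c).natAbs) (xs.drop p) (ys.drop p)).sum

variable {xs ys}

/-- Recursion of the diagonal cost. [folklore] -/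
theorem diagCost_succ {p : ℕ} (hpx : p < xs.length) (hpy : p < ys.length) :
    diagCost xs ys p = (xs[p] - ys[p]).natAbs + diagCost xs ys (p + 1) := by
  unfold diagCost
  rw [List.drop_eq_getElem_cons hpx, List.drop_eq_getElem_cons hpy, List.zipWith_cons_cons,
    List.sum_cons]

/-- Past the end the diagonal cost vanishes. [folklore] -/
theorem diagCost_length : diagCost xs ys xs.length = 0 := by
  unfold diagCost; rw [List.drop_eq_nil_of_le le_rfl]; simp

/-- The diagonal cost is antitone. [folklore] -/
theorem diagCost_succ_le (p : ℕ) : diagCost xs ys (p + 1) ≤ diagCost xs ys p := by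
  by_cases hpx : p < xs.length
  · by_cases hpy : p < ys.length
    · rw [diagCost_succ hpx hpy]; omega
    · unfold diagCost
      rw [List.drop_eq_nil_of_le (show ys.length ≤ p + 1 by omega),
        List.drop_eq_nil_of_le (show ys.length ≤ p by omega)]; simp
  · unfold diagCost
    rw [List.drop_eq_nil_of_le (show xs.length ≤ p + 1 by omega),
      List.drop_eq_nil_of_le (show xs.length ≤ p by omega)]; simp

/-- **Rigid alignment of height-separated sequences.** For low parts in `[0, 3]` and equal
positive lengths, `dtwDist (lift h xs) (lift h ys) = Σ_ℓ |xs_ℓ - ys_ℓ|`: a point at height `6p`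
against one at height `6q`, `p ≠ q`, costs at least `3`, which is at least every same-height
cost, so leaving the diagonal never pays (potential `D (max p q)`); the diagonal traversal
attains the bound. [folklore] -/
theorem dtwDist_lift_lift (hx : ∀ v ∈ xs, 0 ≤ v ∧ v ≤ 3) (hy : ∀ v ∈ ys, 0 ≤ v ∧ v ≤ 3)
    (hlen : xs.length = ys.length) (hpos : 1 ≤ xs.length) (h : ℕ) :
    dtwDist (lift h xs) (lift h ys) = (diagCost xs ys 0 : ℕ∞) := by
  refine le_antisymm ?_ ?_
  · -- the diagonal traversal
    refine (dtwDist_le_sum_zipWith _ _ (by simpa using hlen)).trans (le_of_eq ?_)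
    unfold diagCost
    rw [List.drop_zero, List.drop_zero]
    suffices hz : ∀ (h : ℕ) (xs ys : List ℤ),
        List.zipWith (fun a c => ((a - c).natAbs : ℕ∞)) (lift h xs) (lift h ys) =
          (List.zipWith (fun a c => (a - c).natAbs) xs ys).map (fun n : ℕ => (n : ℕ∞)) by
      rw [hz, ← Nat.cast_list_sum]
    intro h xs ys
    induction xs generalizing h ys with
    | nil => simp [lift]
    | cons v xs ih =>
      cases ys with
      | nil => simp [lift]
      | cons w ys =>
        simp only [lift, List.zipWith_cons_cons, List.map_cons, ih]
        congr 2; ring_nf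
  · -- the potential `D (max p q)`
    have hxL : (lift h xs).length = xs.length := by simp
    have hyL : (lift h ys).length = xs.length := by simp [hlen]
    let Φ : ℕ → ℕ → ℕ∞ := fun p q =>
      if p = xs.length ∧ q = xs.length then 0
      else if p = xs.length ∨ q = xs.length then ⊤ else (diagCost xs ys (max p q) : ℕ∞)
    have hΦ : ∀ p q, p < xs.length → q < xs.length → Φ p q = (diagCost xs ys (max p q) : ℕ∞) :=
      fun p q hp hq => by
        simp only [Φ]; rw [if_neg (by omega), if_neg (by omega)]
    have hΦtop₁ : ∀ q, q < xs.length → Φ xs.length q = ⊤ := fun q hq => by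
      simp only [Φ]; rw [if_neg (by omega)]; simp
    have hΦtop₂ : ∀ p, p < xs.length → Φ p xs.length = ⊤ := fun p hp => by
      simp only [Φ]; rw [if_neg (by omega)]; simp
    have hΦend : Φ xs.length xs.length = 0 := by simp [Φ]
    have h00 : Φ 0 0 = (diagCost xs ys 0 : ℕ∞) := by rw [hΦ 0 0 (by omega) (by omega), max_self]
    rw [← h00]
    refine le_dtwDist_of_local (lift h xs) (lift h ys) Φ (by rw [hxL, hyL]; exact hΦend) ?_
    intro p q hp hq
    rw [hxL] at hp; rw [hyL] at hq
    -- values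
    have hxp : (lift h xs)[p]'(by rw [hxL]; exact hp) = 6 * ((h : ℤ) + p) + xs[p]'(by omega) :=
      getElem_lift _
    have hyq : (lift h ys)[q]'(by rw [hyL]; exact hq) = 6 * ((h : ℤ) + q) + ys[q]'(by omega) :=
      getElem_lift _
    have bx := hx _ (List.getElem_mem (show p < xs.length by omega))
    have bY := hy _ (List.getElem_mem (show q < ys.length by omega))
    -- same-height costs are at most 3
    have c_le : ∀ r (hr : r < xs.length), ((xs[r] - ys[r]'(by omega)).natAbs : ℕ) ≤ 3 := fun r hr => by
      have b1 := hx _ (List.getElem_mem hr)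
      have b2 := hy _ (List.getElem_mem (show r < ys.length by omega))
      omega
    have Drec : ∀ r (hr : r < xs.length),
        diagCost xs ys r = (xs[r] - ys[r]'(by omega)).natAbs + diagCost xs ys (r + 1) :=
      fun r hr => diagCost_succ hr (by omega)
    have DL : diagCost xs ys xs.length = 0 := diagCost_length
    rw [hΦ p q hp hq, hxp, hyq]
    -- the three successors
    rw [← min_add_add_left, ← min_add_add_left]
    rcases lt_trichotomy p q with hpq | rfl | hpq
    · -- p < q : cross cost ≥ 3
      have hc : (3 : ℕ) ≤ (6 * ((h : ℤ) + p) + xs[p] - (6 * ((h : ℤ) + q) + ys[q])).natAbs := by omega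
      have hcq := (c_le q hq).trans hc
      rw [max_eq_right hpq.le]
      refine le_min ?_ (le_min ?_ ?_)
      · -- (p+1, q+1)
        by_cases hq1 : q + 1 = xs.length
        · rw [hq1, hΦtop₂ (p + 1) (by omega)]; simp
        · rw [hΦ (p + 1) (q + 1) (by omega) (by omega), max_eq_right (by omega), Drec q hq]
          push_cast
          exact add_le_add (by exact_mod_cast hcq) le_rfl
      · -- (p+1, q)
        rw [hΦ (p + 1) q (by omega) hq, max_eq_right (by omega)]
        exact le_add_self
      · -- (p, q+1)
        by_cases hq1 : q + 1 = xs.length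
        · rw [hq1, hΦtop₂ p hp]; simp
        · rw [hΦ p (q + 1) hp (by omega), max_eq_right (by omega), Drec q hq]
          push_cast
          exact add_le_add (by exact_mod_cast hcq) le_rfl
    · -- p = q : the diagonal
      rw [max_self, Drec p hp]
      have hc : (6 * ((h : ℤ) + p) + xs[p] - (6 * ((h : ℤ) + p) + ys[p]'(by omega))).natAbs =
          (xs[p] - ys[p]'(by omega)).natAbs := by
        congr 1; ring
      rw [hc]
      push_cast
      refine le_min ?_ (le_min ?_ ?_)
      · by_cases hp1 : p + 1 = xs.length
        · rw [hp1, hΦend, DL]; simp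
        · rw [hΦ (p + 1) (p + 1) (by omega) (by omega), max_self]
      · by_cases hp1 : p + 1 = xs.length
        · rw [hp1, hΦtop₁ p hp]; simp
        · rw [hΦ (p + 1) p (by omega) hp, max_eq_left (by omega)]
      · by_cases hp1 : p + 1 = xs.length
        · rw [hp1, hΦtop₂ p hp]; simp
        · rw [hΦ p (p + 1) hp (by omega), max_eq_right (by omega)]
    · -- q < p : symmetric
      have hc : (3 : ℕ) ≤ (6 * ((h : ℤ) + p) + xs[p] - (6 * ((h : ℤ) + q) + ys[q])).natAbs := by omega
      have hcp := (c_le p hp).trans hc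
      rw [max_eq_left hpq.le]
      refine le_min ?_ (le_min ?_ ?_)
      · by_cases hp1 : p + 1 = xs.length
        · rw [hp1, hΦtop₁ (q + 1) (by omega)]; simp
        · rw [hΦ (p + 1) (q + 1) (by omega) (by omega), max_eq_left (by omega), Drec p hp]
          push_cast
          exact add_le_add (by exact_mod_cast hcp) le_rfl
      · by_cases hp1 : p + 1 = xs.length
        · rw [hp1, hΦtop₁ q hq]; simp
        · rw [hΦ (p + 1) q (by omega) hq, max_eq_left (by omega), Drec p hp]
          push_cast
          exact add_le_add (by exact_mod_cast hcp) le_rfl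
      · rw [hΦ p (q + 1) hp (by omega), max_eq_left (by omega)]
        exact le_add_self

end rigid

/-! ### Coordinate values and vector gadgets -/

/-- `x`-side coordinate value: `xval 1 = 3`, `xval 0 = 1` (low part of the point encoding a bit of
`a`). Compare BK15 Lemma 6.1 (`1_x = 1100`, `0_x = 0110`); one point suffices on the line.
[cite: BringmannKunnemannFOCS2015, Lemma 6.1] -/
def xval (α : Bool) : ℤ := if α then 3 else 1

/-- `y`-side coordinate value: `yval 1 = 0`, `yval 0 = 2`. [cite: BringmannKunnemannFOCS2015, Lemma 6.1] -/
def yval (β : Bool) : ℤ := if β then 0 else 2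

/-- The coordinate values: `|xval α - yval β| = 3` if `α = β = 1` and `= 1` otherwise
(Bringmann–Künnemann, FOCS 2015, Def. 3.2 / Lemma 6.1: `δ(1_x,1_y) > δ(0_x,1_y) = δ(0_x,0_y) = δ(1_x,0_y)`).
[cite: BringmannKunnemannFOCS2015, Lemma 6.1] -/
theorem natAbs_xval_sub_yval (α β : Bool) :
    (xval α - yval β).natAbs = if α && β then 3 else 1 := by
  cases α <;> cases β <;> rfl

/-- The complement point costs `1` against the neutral point `2`: `|xval α - 2| = 1`. [folklore] -/
theorem natAbs_xval_sub_two (α : Bool) : (xval α - 2).natAbs = 1 := by cases α <;> rfl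

/-- Low parts of the `x`-side vector gadget of `a`: `[xval a₀, xval ¬a₀, xval a₁, xval ¬a₁, …]`
(the second point of each pair makes the sum independent of `a`). [folklore] -/
def lowsX : List Bool → List ℤ
  | [] => []
  | α :: a => xval α :: xval (!α) :: lowsX a

/-- Low parts of the `y`-side vector gadget of `b`: `[yval b₀, 2, yval b₁, 2, …]`. [folklore] -/
def lowsY : List Bool → List ℤ
  | [] => []
  | β :: b => yval β :: 2 :: lowsY b

/-- `|lowsX a| = 2 |a|`. [folklore] -/
@[simp] theorem length_lowsX : ∀ a : List Bool, (lowsX a).length = 2 * a.length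
  | [] => rfl
  | _ :: a => by simp [lowsX, length_lowsX a]; ring

/-- `|lowsY b| = 2 |b|`. [folklore] -/
@[simp] theorem length_lowsY : ∀ b : List Bool, (lowsY b).length = 2 * b.length
  | [] => rfl
  | _ :: b => by simp [lowsY, length_lowsY b]; ring

/-- Low parts lie in `[0, 3]` (`x`-side). [folklore] -/
theorem lowsX_bounds : ∀ (a : List Bool), ∀ v ∈ lowsX a, 0 ≤ v ∧ v ≤ 3
  | [], v, hv => by simp [lowsX] at hv
  | α :: a, v, hv => by
    simp only [lowsX, List.mem_cons] at hv
    rcases hv with rfl | rfl | hv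
    · cases α <;> simp [xval]
    · cases α <;> simp [xval]
    · exact lowsX_bounds a v hv

/-- Low parts lie in `[0, 3]` (`y`-side). [folklore] -/
theorem lowsY_bounds : ∀ (b : List Bool), ∀ v ∈ lowsY b, 0 ≤ v ∧ v ≤ 3
  | [], v, hv => by simp [lowsY] at hv
  | β :: b, v, hv => by
    simp only [lowsY, List.mem_cons] at hv
    rcases hv with rfl | rfl | hv
    · cases β <;> simp [yval]
    · norm_num
    · exact lowsY_bounds b v hv

/-- **The sum of the `x`-side low parts does not depend on the vector**: `Σ lowsX a = 4 |a|`
(BK15's "equal type" requirement for the gadgets one level up). [folklore] -/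
theorem sum_lowsX : ∀ a : List Bool, (lowsX a).sum = 4 * a.length
  | [] => rfl
  | α :: a => by
    rw [lowsX, List.sum_cons, List.sum_cons, sum_lowsX a, List.length_cons]
    cases α <;> simp [xval] <;> ring

/-- The number of coordinates where both vectors are `1` (the inner product `⟨a, b⟩`). [folklore] -/
def ip : List Bool → List Bool → ℕ
  | α :: a, β :: b => (if α && β then 1 else 0) + ip a b
  | _, _ => 0

/-- The inner product of equal-length bit lists vanishes iff no coordinate has both bits set.
[folklore] -/
theorem ip_eq_zero_iff : ∀ (a b : List Bool) (h : a.length = b.length),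
    (ip a b = 0 ↔ ∀ k (hk : k < a.length), ¬ (a[k] = true ∧ b[k]'(by omega) = true))
  | [], [], _ => by simp [ip]
  | [], _ :: _, h => by simp at h
  | _ :: _, [], h => by simp at h
  | α :: a, β :: b, h => by
    have ih := ip_eq_zero_iff a b (by simpa using h)
    rw [ip, Nat.add_eq_zero_iff, ih]
    constructor
    · rintro ⟨h0, hr⟩ k hk
      cases k with
      | zero =>
        simp only [List.getElem_cons_zero]
        cases α <;> cases β <;> simp at h0 ⊢
      | succ k =>
        simp only [List.getElem_cons_succ]
        exact hr k (by simpa using hk)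
    · intro hall
      refine ⟨?_, fun k hk => ?_⟩
      · have h0 := hall 0 (by simp)
        simp only [List.getElem_cons_zero] at h0
        cases α <;> cases β <;> simp at h0 ⊢
      · have := hall (k + 1) (by simpa using hk)
        simpa only [List.getElem_cons_succ] using this

/-- **The diagonal cost of the vector gadgets**: `Σ_ℓ |lowsX a _ℓ - lowsY b _ℓ| = 2 |a| + 2 ⟨a, b⟩`.
[cite: BringmannKunnemannFOCS2015, Claim 3.4 (analogue)] -/
theorem diagCost_lows : ∀ (a b : List Bool), a.length = b.length →
    diagCost (lowsX a) (lowsY b) 0 = 2 * a.length + 2 * ip a b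
  | [], [], _ => by simp [diagCost, lowsX, lowsY, ip]
  | [], _ :: _, h => by simp at h
  | _ :: _, [], h => by simp at h
  | α :: a, β :: b, h => by
    have ih := diagCost_lows a b (by simpa using h)
    unfold diagCost at ih ⊢
    rw [List.drop_zero, List.drop_zero] at ih ⊢
    rw [lowsX, lowsY, List.zipWith_cons_cons, List.zipWith_cons_cons, List.sum_cons, List.sum_cons,
      ih, natAbs_xval_sub_yval, natAbs_xval_sub_two, ip, List.length_cons]
    cases (α && β) <;> simp <;> ring

/-- The `x`-side vector gadget of `a` at base height `hb`: the lifted low parts. [folklore] -/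
def vgX (hb : ℕ) (a : List Bool) : List ℤ := lift hb (lowsX a)

/-- The `y`-side vector gadget of `b` at base height `hb`. [folklore] -/
def vgY (hb : ℕ) (b : List Bool) : List ℤ := lift hb (lowsY b)

/-- Lengths of the vector gadgets. [folklore] -/
@[simp] theorem length_vgX (hb : ℕ) (a : List Bool) : (vgX hb a).length = 2 * a.length := by
  simp [vgX]

/-- Lengths of the vector gadgets. [folklore] -/
@[simp] theorem length_vgY (hb : ℕ) (b : List Bool) : (vgY hb b).length = 2 * b.length := by
  simp [vgY]

/-- Values of the `x`-side vector gadget lie in `[0, 6 (hb + 2|a|) - 3]`. [folklore] -/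
theorem vgX_bounds (hb : ℕ) (a : List Bool) : ∀ w ∈ vgX hb a, 0 ≤ w ∧ w ≤ 6 * ((hb : ℤ) + 2 * a.length) - 3 := by
  intro w hw
  have := bounds_of_mem_lift (lowsX_bounds a) hw
  simpa using this

/-- Values of the `y`-side vector gadget lie in `[0, 6 (hb + 2|b|) - 3]`. [folklore] -/
theorem vgY_bounds (hb : ℕ) (b : List Bool) : ∀ w ∈ vgY hb b, 0 ≤ w ∧ w ≤ 6 * ((hb : ℤ) + 2 * b.length) - 3 := by
  intro w hw
  have := bounds_of_mem_lift (lowsY_bounds b) hw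
  simpa using this

/-- **The sum of the `x`-side vector gadget depends only on `|a|` (and the base height).**
[folklore] -/
theorem sum_vgX (hb : ℕ) (a : List Bool) :
    (vgX hb a).sum = 4 * a.length + 6 * (∑ ℓ ∈ Finset.range (2 * a.length), ((hb : ℤ) + ℓ)) := by
  rw [vgX, sum_lift, sum_lowsX, length_lowsX]

/-- **The distance of the vector gadgets** (Bringmann–Künnemann, FOCS 2015, Claim 3.4, in our
rigid variant): `dtwDist (vgX hb a) (vgY hb b) = 2 |a| + 2 ⟨a, b⟩` for `|a| = |b| ≥ 1`. In
particular it is `2|a|` iff `a ⊥ b` and `≥ 2|a| + 2` otherwise.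
[cite: BringmannKunnemannFOCS2015, Claim 3.4] -/
theorem dtwDist_vgX_vgY (hb : ℕ) (a b : List Bool) (hlen : a.length = b.length) (hpos : 1 ≤ a.length) :
    dtwDist (vgX hb a) (vgY hb b) = ((2 * a.length + 2 * ip a b : ℕ) : ℕ∞) := by
  rw [vgX, vgY, dtwDist_lift_lift (lowsX_bounds a) (lowsY_bounds b) (by simp [hlen]) (by simp; omega),
    diagCost_lows a b hlen]

end DTWRed

end Literature.Computability.FineGrained
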